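import Literature.Computability.Complexity.CountingHierarchy
import Literature.Computability.Complexity.CoinTruncation
import Literature.Computability.Complexity.MapFstMachine
import Literature.Computability.Complexity.PairProjections
import Literature.Computability.Complexity.StringCopy
import Literature.Computability.Complexity.ReductionsProofs
import Literature.Computability.Complexity.AdviceBasics
import HarnessLib

/-!
# The counting hierarchy is closed under polynomial-time reductions (proofs; trunk CplxCore)

Sibling proof file of `CountingHierarchy.lean` (D-0014). Structural facts about Wagner's counting
hierarchy `CH = ⋃ₖ CₖP`, `Cₖ₊₁P = C'·CₖP` (majority operator `pMajority`), all PROVED here from the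
tree's `FinTM2` toolkit:

* `uniformProb_take_of_le` — cylinder events: for `m ≤ M`,
  `Pr_{y ∈ {0,1}^M}[y↾m ∈ E] = Pr_{y ∈ {0,1}^m}[y ∈ E]` (counting; each prefix has `2^{M-m}`
  extensions);
* `preimage_mem_pMajority` — **the majority operator preserves closure under Karp reductions**:
  if `K` is closed under preimages of `FP` maps then so is `C'·K`. Printed remark (Torán 1991, §3;
  Bürgisser 2009, Rem. 2.2: the operators "behave well"); the proof re-pairs and *truncates the
  coins*: for `x ∈ f⁻¹(L)` iff a majority of `y ∈ {0,1}^{p(|f x|)}` has `⟨f x, y⟩ ∈ L''`, use the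
  witness language `{⟨x, y'⟩ | ⟨f x, y'↾p(|f x|)⟩ ∈ L''} = (truncSndFn p ∘ mapFstFn f)⁻¹(L'') ∈ K`
  (`CoinTruncation.lean`, `MapFstMachine.lean`) with `p(s(|x|)) ≥ p(|f x|)` coins, whose
  acceptance probability is unchanged by the cylinder lemma;
* `preimage_mem_CkP`, `preimage_mem_PP`, `preimage_mem_CH`, `mem_CH_of_karpReducible` — every level
  `CₖP`, in particular `PP = C₁P`, and `CH` are closed downward under `≤ₚ`;
* `CkP_closed_fst`, `CH_closed_fst` — closure under the first projection `z ↦ (boolUnpair z).1`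
  (in `FP` by `PairProjections.boolUnpairFst_mem_FP`, a finite-state transduction);
* `inter_P_mem_CkP`, `union_P_mem_CkP`, `inter_P_mem_CH`, `union_P_mem_CH` — intersections and
  unions with `P` languages stay in `CₖP` / `CH` (`StringCopy.inter_mem_of_preimage_closed`: copy
  the input, decide the `P` language on one copy, select);
* `CkP_subset_CkP_succ_holds` — **discharge of the named fact `CkP_subset_CkP_succ`**
  (cumulativity `CₖP ⊆ Cₖ₊₁P`: ignore the coins, Bürgisser 2009, Rem. 2.2), and `CkP_mono`,
  `P_subset_CkP`;
* `CH_subset_polyAdvice_CH` — `CH ⊆ CH/poly` with empty advice (Bürgisser 2009, Def. 2.4), the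
  hypothesis of `Literature.Computability.AlgebraicComplexity.Burgisser2009_thm41_2_uniform_of`; likewise `PP_subset_polyAdvice_PP`.

## References

* J. Torán, *Complexity classes defined by counting quantifiers*, J. ACM 38 (1991) 753–774, §3.
* P. Bürgisser, *On defining integers and proving arithmetic circuit lower bounds*, Comput.
  Complexity 18 (2009) 81–103 = ECCC TR06-113 (2006), §2.1, Rem. 2.2, Def. 2.4.
* S. Arora, B. Barak, *Computational Complexity: A Modern Approach*, CUP 2009, §0.1, Thm. 2.8,
  Def. 7.3, §17.2.1 (`PP`).
-/

namespace Literature.Computability.Complexity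

open _root_.Computability Polynomial

/-! ### Cylinder events have the probability of their base -/

/-- **Prefix events.** For `E ⊆ {0,1}*` and `d` extra coins,
`Pr_{y ∈ {0,1}^{m+d}}[y↾m ∈ E] = Pr_{y ∈ {0,1}^m}[y ∈ E]`: the strings of length `m + d` with prefix
in `E` correspond to `(E ∩ {0,1}^m) × {0,1}^d`. [Arora–Barak 2009, §7.1 (irrelevant coins)] [folklore] -/
theorem uniformProb_take_add (m d : ℕ) (E : Set (List Bool)) :
    uniformProb (m + d) {y | y.take m ∈ E} = uniformProb m E := by
  classical
  let e : {r : List.Vector Bool (m + d) // r.toList.take m ∈ E} ≃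
      {r : List.Vector Bool m // r.toList ∈ E} × List.Vector Bool d :=
    { toFun := fun r =>
        (⟨⟨r.1.toList.take m, by simp [r.1.toList_length]⟩, r.2⟩,
          ⟨r.1.toList.drop m, by simp [r.1.toList_length]⟩)
      invFun := fun q =>
        ⟨⟨q.1.1.toList ++ q.2.toList, by simp [q.1.1.toList_length, q.2.toList_length]⟩, by
          change (q.1.1.toList ++ q.2.toList).take m ∈ E
          rw [List.take_left' q.1.1.toList_length]
          exact q.1.2⟩
      left_inv := by
        rintro ⟨⟨r, hr⟩, h⟩
        apply Subtype.ext
        apply Subtype.ext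
        exact List.take_append_drop m r
      right_inv := by
        rintro ⟨⟨⟨a, ha⟩, h⟩, ⟨b, hb⟩⟩
        refine Prod.ext (Subtype.ext (Subtype.ext ?_)) (Subtype.ext ?_)
        · exact List.take_left' ha
        · exact List.drop_left' ha }
  have hcard : (Finset.univ.filter fun r : List.Vector Bool (m + d) => r.toList.take m ∈ E).card =
      (Finset.univ.filter fun r : List.Vector Bool m => r.toList ∈ E).card * 2 ^ d := by
    have h1 := Fintype.card_congr e
    rw [Fintype.card_prod, card_vector, Fintype.card_bool, Fintype.card_subtype,
      Fintype.card_subtype] at h1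
    exact h1
  show ((Finset.univ.filter fun r : List.Vector Bool (m + d) => r.toList.take m ∈ E).card : ℝ) /
      2 ^ (m + d) = ((Finset.univ.filter fun r : List.Vector Bool m => r.toList ∈ E).card : ℝ) / 2 ^ m
  rw [hcard]
  push_cast
  rw [pow_add]
  field_simp

/-- **Cylinder events**, monotone form: for `m ≤ M`, `Pr_{y ∈ {0,1}^M}[y↾m ∈ E] = Pr_{y ∈ {0,1}^m}[E]`.
[Arora–Barak 2009, §7.1] [folklore] -/
theorem uniformProb_take_of_le {m M : ℕ} (h : m ≤ M) (E : Set (List Bool)) :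
    uniformProb M {y | y.take m ∈ E} = uniformProb m E := by
  obtain ⟨d, rfl⟩ := Nat.exists_eq_add_of_le h
  exact uniformProb_take_add m d E

/-! ### Output length of `FP` functions -/

/-- An `FP` function has polynomially bounded output length: `|f x| ≤ |x| + D · p(|x|)` for the
time polynomial `p` and push bound `D` of its machine (`OutputsWithin.length_le`).
[Arora–Barak 2009, §1.3] [folklore] -/
theorem exists_poly_length_le_of_mem_FP {f : List Bool → List Bool} (hf : f ∈ FP) :
    ∃ s : Polynomial ℕ, ∀ x, (f x).length ≤ s.eval x.length := by
  obtain ⟨p, M, hM⟩ := hf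
  refine ⟨X + C (TM2Comp.machinePushBound M.tm) * p, fun x => ?_⟩
  have h := (hM x).length_le
  simpa using h

/-! ### The majority operator preserves closure under polynomial-time preimages -/

/-- **`C'·K` is closed under `FP` preimages when `K` is.** For `L ∈ C'·K` with witness `L'' ∈ K`
and coin polynomial `p`, and `f ∈ FP` with `|f x| ≤ s(|x|)`, the language `f⁻¹(L)` has the witness
`(truncSndFn p ∘ mapFstFn f)⁻¹(L'') = {⟨x, y'⟩ | ⟨f x, y'↾p(|f x|)⟩ ∈ L''} ∈ K` and coin polynomial
`p ∘ s`; the acceptance probabilities agree by `uniformProb_take_of_le`. (Torán 1991, §3;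
Bürgisser 2009, Rem. 2.2; the coin truncation is Arora–Barak's normal form, Def. 7.3.) [cite: Toran1991, §3] -/
theorem preimage_mem_pMajority {K : Set (Language Bool)}
    (hK : ∀ ⦃L : Language Bool⦄, L ∈ K → ∀ ⦃g : List Bool → List Bool⦄, g ∈ FP → g ⁻¹' L ∈ K)
    {L : Language Bool} (hL : L ∈ pMajority K) {f : List Bool → List Bool} (hf : f ∈ FP) :
    f ⁻¹' L ∈ pMajority K := by
  obtain ⟨L'', hL'', p, hp⟩ := hL
  obtain ⟨s, hs⟩ := exists_poly_length_le_of_mem_FP hf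
  refine ⟨(truncSndFn p ∘ mapFstFn f) ⁻¹' L'',
    hK hL'' (comp_mem_FP (truncSndFn_mem_FP p) (mapFstFn_mem_FP hf)), p.comp s, fun x => ?_⟩
  set L₃ : Language Bool := (truncSndFn p ∘ mapFstFn f) ⁻¹' L'' with hL₃
  change f x ∈ L ↔ 1 / 2 < uniformProb ((p.comp s).eval x.length) {y : List Bool | boolPair x y ∈ L₃}
  rw [hp (f x)]
  have hset : {y : List Bool | boolPair x y ∈ L₃} =
      {y | y.take (p.eval (f x).length) ∈ {y | boolPair (f x) y ∈ L''}} := by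
    ext y
    change truncSndFn p (mapFstFn f (boolPair x y)) ∈ L'' ↔
      boolPair (f x) (y.take (p.eval (f x).length)) ∈ L''
    rw [mapFstFn_boolPair, truncSndFn_boolPair]
  rw [hset, eval_comp, uniformProb_take_of_le (TM2Iter.eval_mono p (hs x))]

/-! ### Every level of the counting hierarchy is closed under Karp reductions -/

/-- **`CₖP` is closed under polynomial-time preimages**, by induction on `k` from `preimage_mem_P`
and `preimage_mem_pMajority` (Torán 1991, §3; Bürgisser 2009, Rem. 2.2). [cite: Toran1991, §3] -/
theorem preimage_mem_CkP (k : ℕ) :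
    ∀ ⦃L : Language Bool⦄, L ∈ CkP k → ∀ ⦃f : List Bool → List Bool⦄, f ∈ FP → f ⁻¹' L ∈ CkP k := by
  induction k with
  | zero => intro L hL f hf; exact preimage_mem_P hL hf
  | succ k ih => intro L hL f hf; exact preimage_mem_pMajority ih hL hf

/-- **`PP` is closed under polynomial-time preimages** (`PP = C₁P`; Gill 1977; Arora–Barak 2009,
§17.2.1). [cite: Toran1991, §3] -/
theorem preimage_mem_PP {L : Language Bool} (hL : L ∈ PP) {f : List Bool → List Bool}
    (hf : f ∈ FP) : f ⁻¹' L ∈ PP :=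
  preimage_mem_CkP 1 hL hf

/-- **`CH` is closed under polynomial-time preimages.** [cite: Toran1991, §3] -/
theorem preimage_mem_CH {L : Language Bool} (hL : L ∈ CH) {f : List Bool → List Bool}
    (hf : f ∈ FP) : f ⁻¹' L ∈ CH := by
  obtain ⟨k, hk⟩ := mem_CH_iff.1 hL
  exact CkP_subset_CH k (preimage_mem_CkP k hk hf)

open scoped Notation in
/-- **`CH` is closed downward under Karp reductions**: `L₁ ≤ₚ L₂`, `L₂ ∈ CH` ⇒ `L₁ ∈ CH`.
[cite: Toran1991, §3] -/
theorem mem_CH_of_karpReducible {L₁ L₂ : Language Bool} (h : L₁ ≤ₚ L₂) (h₂ : L₂ ∈ CH) :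
    L₁ ∈ CH := by
  obtain ⟨f, hf, hfL⟩ := h
  have hpre : L₁ = f ⁻¹' L₂ := Set.ext hfL
  rw [hpre]
  exact preimage_mem_CH h₂ hf

open scoped Notation in
/-- **`CₖP` is closed downward under Karp reductions.** [cite: Toran1991, §3] -/
theorem mem_CkP_of_karpReducible {k : ℕ} {L₁ L₂ : Language Bool} (h : L₁ ≤ₚ L₂)
    (h₂ : L₂ ∈ CkP k) : L₁ ∈ CkP k := by
  obtain ⟨f, hf, hfL⟩ := h
  have hpre : L₁ = f ⁻¹' L₂ := Set.ext hfL
  rw [hpre]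
  exact preimage_mem_CkP k h₂ hf

/-! ### Closure under the first projection of the pairing -/

/-- `CₖP` is closed under the first projection of the pairing: `{w | (boolUnpair w).1 ∈ L} ∈ CₖP`
for `L ∈ CₖP`. [cite: Toran1991, §3] -/
theorem CkP_closed_fst (k : ℕ) : ∀ L ∈ CkP k, {w | (boolUnpair w).1 ∈ L} ∈ CkP k :=
  fun _ hL => preimage_mem_CkP k hL boolUnpairFst_mem_FP

/-- `CH` is closed under the first projection of the pairing. [cite: Toran1991, §3] -/
theorem CH_closed_fst : ∀ L ∈ CH, {w | (boolUnpair w).1 ∈ L} ∈ CH :=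
  fun _ hL => preimage_mem_CH hL boolUnpairFst_mem_FP

/-! ### Cumulativity and `CH ⊆ CH/poly` -/

/-- **`K ⊆ C'·K` for every class closed under the first projection** ("ignore the coins": with the
witness `{w | (boolUnpair w).1 ∈ L}` every coin string is accepting iff `x ∈ L`, so the acceptance
probability is `1` or `0`; Bürgisser 2009, Rem. 2.2; Torán 1991, §3). [cite: Burgisser2006, Remark 2.2] -/
theorem subset_pMajority_of_closed_fst {K : Set (Language Bool)}
    (hK : ∀ L ∈ K, {w | (boolUnpair w).1 ∈ L} ∈ K) : K ⊆ pMajority K := by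
  intro L hL
  set L' : Language Bool := {w | (boolUnpair w).1 ∈ L} with hL'
  refine ⟨L', hK L hL, 0, fun x => ?_⟩
  have hmem : ∀ y : List Bool, boolPair x y ∈ L' ↔ x ∈ L := fun y => by
    change (boolUnpair (boolPair x y)).1 ∈ L ↔ x ∈ L
    rw [boolUnpair_boolPair]
  by_cases hx : x ∈ L
  · have hset : {y : List Bool | boolPair x y ∈ L'} = Set.univ :=
      Set.eq_univ_of_forall fun y => (hmem y).2 hx
    rw [hset, uniformProb_univ]
    simp only [hx, true_iff]
    norm_num
  · have hset : {y : List Bool | boolPair x y ∈ L'} = ∅ :=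
      Set.eq_empty_of_forall_notMem fun y hy => hx ((hmem y).1 hy)
    rw [hset, uniformProb_empty]
    simp only [hx, false_iff, not_lt]
    norm_num

/-- **Discharge of `CkP_subset_CkP_succ`**: the counting hierarchy is cumulative, `CₖP ⊆ Cₖ₊₁P`
(Bürgisser 2009, Rem. 2.2; Torán 1991, §3). [cite: Burgisser2006, Remark 2.2] -/
theorem CkP_subset_CkP_succ_holds : CkP_subset_CkP_succ :=
  fun k => subset_pMajority_of_closed_fst (CkP_closed_fst k)

/-- Monotonicity of the levels: `CⱼP ⊆ CₖP` for `j ≤ k`. [cite: Burgisser2006, Remark 2.2] -/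
theorem CkP_mono {j k : ℕ} (h : j ≤ k) : CkP j ⊆ CkP k := by
  induction h with
  | refl => exact le_rfl
  | step _ ih => exact ih.trans (CkP_subset_CkP_succ_holds _)

/-- `P ⊆ CₖP` for every `k`. [cite: Burgisser2006, Remark 2.2] -/
theorem P_subset_CkP (k : ℕ) : Classes.P ⊆ CkP k :=
  CkP_mono (Nat.zero_le k)

/-- `PP ⊆ CₖP` for every `k ≥ 1`. [cite: Burgisser2006, Remark 2.2] -/
theorem PP_subset_CkP {k : ℕ} (hk : 1 ≤ k) : PP ⊆ CkP k :=
  CkP_mono hk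

/-- **`CH ⊆ CH/poly`** (empty advice; Bürgisser 2009, Def. 2.4: the nonuniform class contains the
uniform one), the hypothesis `hCH` of `Literature.Computability.AlgebraicComplexity.Burgisser2009_thm41_2_uniform_of`. [cite: Burgisser2006, Def. 2.4] -/
theorem CH_subset_polyAdvice_CH : CH ⊆ polyAdvice CH :=
  subset_polyAdvice_of_closed_fst CH CH_closed_fst

/-- `CₖP ⊆ CₖP/poly` (empty advice). [cite: Burgisser2006, Def. 2.4] -/
theorem CkP_subset_polyAdvice_CkP (k : ℕ) : CkP k ⊆ polyAdvice (CkP k) :=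
  subset_polyAdvice_of_closed_fst (CkP k) (CkP_closed_fst k)

/-- `PP ⊆ PP/poly` (empty advice). [cite: Burgisser2006, Def. 2.4] -/
theorem PP_subset_polyAdvice_PP : PP ⊆ polyAdvice PP :=
  CkP_subset_polyAdvice_CkP 1

/-! ### Intersections and unions with `P` languages -/

/-- `L₁ ∈ P`, `L₂ ∈ CₖP` ⇒ `L₁ ⊓ L₂ ∈ CₖP` (`⊓ = ∩` on languages). [cite: Toran1991, §3] -/
theorem inter_P_mem_CkP {k : ℕ} {L₁ L₂ : Language Bool} (h₁ : L₁ ∈ Classes.P) (h₂ : L₂ ∈ CkP k) :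
    L₁ ⊓ L₂ ∈ CkP k :=
  inter_mem_of_preimage_closed (preimage_mem_CkP k) (P_subset_CkP k) h₁ h₂

/-- `L₁ ∈ P`, `L₂ ∈ CₖP` ⇒ `L₁ ⊔ L₂ ∈ CₖP` (`⊔ = ∪` on languages). [cite: Toran1991, §3] -/
theorem union_P_mem_CkP {k : ℕ} {L₁ L₂ : Language Bool} (h₁ : L₁ ∈ Classes.P) (h₂ : L₂ ∈ CkP k) :
    L₁ ⊔ L₂ ∈ CkP k :=
  union_mem_of_preimage_closed (preimage_mem_CkP k) (P_subset_CkP k) h₁ h₂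

/-- `L₁ ∈ P`, `L₂ ∈ CH` ⇒ `L₁ ⊓ L₂ ∈ CH`. [cite: Toran1991, §3] -/
theorem inter_P_mem_CH {L₁ L₂ : Language Bool} (h₁ : L₁ ∈ Classes.P) (h₂ : L₂ ∈ CH) : L₁ ⊓ L₂ ∈ CH :=
  inter_mem_of_preimage_closed (fun _ hL _ hg => preimage_mem_CH hL hg) P_subset_CH h₁ h₂

/-- `L₁ ∈ P`, `L₂ ∈ CH` ⇒ `L₁ ⊔ L₂ ∈ CH`. [cite: Toran1991, §3] -/
theorem union_P_mem_CH {L₁ L₂ : Language Bool} (h₁ : L₁ ∈ Classes.P) (h₂ : L₂ ∈ CH) : L₁ ⊔ L₂ ∈ CH :=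
  union_mem_of_preimage_closed (fun _ hL _ hg => preimage_mem_CH hL hg) P_subset_CH h₁ h₂

end Literature.Computability.Complexity
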